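/-
Copyright (c) 2026 the pub-hodgecm-mathlib formalisation cell (harness21).  Prover seat hodgecm-mathlib-K2Liu-p13 (g0), Track B «K2-LIT»,
#184♮ = hLiu418 = `stmt-HodgeConjecture-24832`; Road I v3 organ U1-CT-ind STAGE 2 (Q2), file F4-0 (LEAD F0P6-plan (g13) 09:57:20Z «GO (Q2) F4»).
-/
import Summits.HodgeConjecture.HodgeConjecture.Theorems.K2LiuKlingenParabolicDefs   -- ★ F1: `siegelFour`, `klingen`, `klingenLevi`, `nKlingen`, `weylXi` + tables
import HarnessLib

/-!
# Crux `HLiu418`, Road I v3, organ U1 stage 2 (Q2), file F4-0: THE HEISENBERG UNIPOTENT RADICAL `N_Q ≤ U(J₄)` AS A SUBGROUP — group law, inverse,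
# `N_Q ≤ P ∩ Q`, and the cell-`ξ` stabiliser `N_Q ∩ ξ⁻¹ P ξ = u_{e₁+e₂}`

Cell `hodgecm-mathlib`, crux item hLiu418 = `stmt-HodgeConjecture-24832`; squad K2 ∕ K2Liu; LEAD F0P6-plan (g13), co-dealer K2E5-plan (g7); prover K2Liu-p13 (g0).
DEFINITIONS WITH BODIES + their algebra (review lane `--kind definition`, `--supports stmt-HodgeConjecture-24832 --as helper`); no `instance`, no notation,
no named-fact hypothesis, no `sorry`.  Pure algebra over a commutative ring `R` with an involutive ring endomorphism `σ`, in the frame of ★ B1a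
`K2LiuDoubledUTwoTwoBorelFrame` (K2Liu-p03) and ★ F1 `K2LiuKlingenParabolicDefs`: `G = U(J₄)(R, σ)`, `J₄ = antidiag(1,1,1,1)`, indices `Fin 4 = {0,1,2,3}`.

WHY.  The Q-constant term `∫_{N_Q(L⁺)\N_Q(𝔸)} E(u h; f) du` of the Siegel Eisenstein series on `U(2,2)` (file F4 `K2LiuKlingenConstantTermUnfold`) unfolds over the
two cells `P·Q ⊔ P·ξ·Q` (★ F2) by regrouping the Eisenstein sum into `N_Q(L⁺)`-orbits; this needs `N_Q` as a GROUP (not only the letter `n_Q(y,z,t)` of ★ F1):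
* §1 the HEISENBERG RELATIONS: `u_{2e₁}` is central in `N_Q` (`uLongOne_mul_uPlus`, `uLongOne_mul_uMinus`), the commutator
  `u_{e₁−e₂}(t) u_{e₁+e₂}(z) = u_{e₁+e₂}(z) u_{e₁−e₂}(t) u_{2e₁}(z σt − t σz)` (`uMinus_mul_uPlus`), the GROUP LAW
  `n_Q(y,z,t) · n_Q(y',z',t') = n_Q(y + y' + (z' σt − t σz'), z + z', t + t')` (`nKlingen_mul`), `n_Q(0,0,0) = 1`, and the inverse
  `n_Q(y,z,t)⁻¹ = n_Q(−y + (z σt − t σz), −z, −t)` (`nKlingen_inv`);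
* §2 `klingenUnip hσ : Subgroup U(J₄)` — `N_Q = {n_Q(y,z,t)}` (closed by §1), `N_Q ≤ P` (★ F1 `nKlingen_mem`: the Siegel section will be LEFT-`N_Q(𝔸)`-invariant, so the
  identity cell of the Q-constant term is `vol · f`) and `N_Q ≤ Q`; the coordinates are READ OFF THE MATRIX (`t = g₀₁`, `z = g₀₂`, `y = g₀₃ + g₀₂ σ(g₀₁)`:
  `nKlingen_entry_*`), so rational points have rational coordinates;
* §3 THE CELL-`ξ` STABILISER: `ξ n_Q(y,z,t) ξ⁻¹ ∈ P ↔ y = 0 ∧ t = 0` (`weylXi_conj_nKlingen_mem_siegelFour_iff`) — `N_Q ∩ ξ⁻¹Pξ = u_{e₁+e₂}(R)`, so the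
  cell-`ξ` orbit integral is over `u_{e₁+e₂}(L⁺)\N_Q(𝔸)` and, after the compact `u_{e₁+e₂}(L⁺)\u_{e₁+e₂}(𝔸)` is integrated out (`ξ u_{e₁+e₂} ξ⁻¹ ⊂ P`,
  ★ F1 `weylXi_mul_uPlus`), over the two flipped root groups: `M(ξ,s)f = ∫∫ f(ξ u_{2e₁}(y) u_{e₁−e₂}(t) ·) dy dt`.
[Xiong2013 = corpus:paper-arxiv-1205.6025, §7 Lemma 7.1], [GanTakeda2011SiegelWeil = corpus:paper-arxiv-0902.0419, §7.2 p. 23], [MoeglinWaldspurger1995, I.2.1, II.1.7],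
[Casselman1980, §3], [Rogawski1990, §1.9].
HONEST LABEL.  Carriers only, count-neutral: `HC_CM` is proved only modulo the 7 printed citations (2 remaining named inputs: hLiu418 = `stmt-HodgeConjecture-24832`,
h413 = `stmt-HodgeConjecture-24833`) until rung 0 closes.
-/

set_option autoImplicit false
set_option linter.dupNamespace false -- the mandated namespace repeats `HodgeConjecture.HodgeConjecture`

noncomputable section

open Matrix
open Literature.NumberTheory.Automorphic
open Summit.HodgeConjecture.HodgeConjecture.Cruxes.HLiu418.K2LiuDoubledUTwoTwoBorelFrame
open Summit.HodgeConjecture.HodgeConjecture.Cruxes.HLiu418.K2LiuDoubledUTwoTwoWeylCocycle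
open Summit.HodgeConjecture.HodgeConjecture.Cruxes.HLiu418.K2LiuDoubledUTwoTwoLevi
open Summit.HodgeConjecture.HodgeConjecture.Cruxes.HLiu418.K2LiuKlingenParabolicDefs

namespace Summit.HodgeConjecture.HodgeConjecture.Cruxes.HLiu418.K2LiuKlingenUnipotentDefs

variable {R : Type*} [CommRing R] {σ : R →+* R}

/-! ## §1 The Heisenberg relations of `N_Q = u_{2e₁} · u_{e₁+e₂} · u_{e₁−e₂}` -/

/-- sums of `σ`-skew elements are `σ`-skew. [cite: Rogawski1990, §1.9] -/
theorem skew_add {y y' : R} (hy : σ y = -y) (hy' : σ y' = -y') : σ (y + y') = -(y + y') := by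
  rw [map_add, hy, hy', neg_add]

/-- negatives of `σ`-skew elements are `σ`-skew. [cite: Rogawski1990, §1.9] -/
theorem skew_neg {y : R} (hy : σ y = -y) : σ (-y) = -(-y) := by
  rw [map_neg, hy]

/-- the Heisenberg commutator value `z σ(t) − t σ(z)` is `σ`-skew (`σ` involutive). [cite: Rogawski1990, §1.9] -/
theorem skew_comm (hσ : ∀ x, σ (σ x) = x) (z t : R) : σ (z * σ t - t * σ z) = -(z * σ t - t * σ z) := by
  rw [map_sub, map_mul, map_mul, hσ, hσ]; ring

/-- `σ 0 = -0`. [cite: Rogawski1990, §1.9] -/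
theorem skew_zero : σ (0 : R) = -0 := by rw [map_zero, neg_zero]

/-- **`u_{2e₁}` is central in `N_Q`, I**: `u_{2e₁}(y) u_{e₁+e₂}(z) = u_{e₁+e₂}(z) u_{2e₁}(y)`. [cite: Rogawski1990, §1.9] [cite: Xiong2013, §7 Lemma 7.1] -/
theorem uLongOne_mul_uPlus (hσ : ∀ x, σ (σ x) = x) (y : R) (hy : σ y = -y) (z : R) :
    uLongOne R σ y hy * uPlus R σ hσ z = uPlus R σ hσ z * uLongOne R σ y hy := by
  apply ext_of_coe
  rw [Subgroup.coe_mul, Units.val_mul, Subgroup.coe_mul, Units.val_mul, coe_uLongOne, coe_uPlus]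
  ext i j
  fin_cases i <;> fin_cases j <;> simp [uLongOneM, uPlusM, Matrix.mul_apply, Fin.sum_univ_four]

/-- **`u_{2e₁}` is central in `N_Q`, II**: `u_{2e₁}(y) u_{e₁−e₂}(t) = u_{e₁−e₂}(t) u_{2e₁}(y)`. [cite: Rogawski1990, §1.9] [cite: Xiong2013, §7 Lemma 7.1] -/
theorem uLongOne_mul_uMinus (hσ : ∀ x, σ (σ x) = x) (y : R) (hy : σ y = -y) (t : R) :
    uLongOne R σ y hy * uMinus R σ hσ t = uMinus R σ hσ t * uLongOne R σ y hy := by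
  apply ext_of_coe
  rw [Subgroup.coe_mul, Units.val_mul, Subgroup.coe_mul, Units.val_mul, coe_uLongOne, coe_uMinus]
  ext i j
  fin_cases i <;> fin_cases j <;> simp [uLongOneM, uMinusM, Matrix.mul_apply, Fin.sum_univ_four]

/-- **THE HEISENBERG COMMUTATOR**: `u_{e₁−e₂}(t) · u_{e₁+e₂}(z) = u_{e₁+e₂}(z) · u_{e₁−e₂}(t) · u_{2e₁}(z σ(t) − t σ(z))` — `[u_{e₁−e₂}, u_{e₁+e₂}] ⊂ u_{2e₁}`, the
centre. [cite: Rogawski1990, §1.9] [cite: Xiong2013, §7 Lemma 7.1] -/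
theorem uMinus_mul_uPlus (hσ : ∀ x, σ (σ x) = x) (t z : R) :
    uMinus R σ hσ t * uPlus R σ hσ z = uPlus R σ hσ z * uMinus R σ hσ t * uLongOne R σ (z * σ t - t * σ z) (skew_comm hσ z t) := by
  apply ext_of_coe
  rw [Subgroup.coe_mul, Units.val_mul, Subgroup.coe_mul, Units.val_mul, Subgroup.coe_mul, Units.val_mul, coe_uMinus, coe_uPlus, coe_uLongOne]
  ext i j
  fin_cases i <;> fin_cases j <;> simp [uLongOneM, uPlusM, uMinusM, Matrix.mul_apply, Fin.sum_univ_four]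
  ring

/-- **THE GROUP LAW OF `N_Q`** (Heisenberg): `n_Q(y,z,t) · n_Q(y',z',t') = n_Q(y + y' + (z' σ(t) − t σ(z')), z + z', t + t')`.
[cite: Rogawski1990, §1.9] [cite: Xiong2013, §7 Lemma 7.1] -/
theorem nKlingen_mul (hσ : ∀ x, σ (σ x) = x) (y : R) (hy : σ y = -y) (z t : R) (y' : R) (hy' : σ y' = -y') (z' t' : R) :
    nKlingen R σ hσ y hy z t * nKlingen R σ hσ y' hy' z' t' =
      nKlingen R σ hσ (y + y' + (z' * σ t - t * σ z')) (skew_add (skew_add hy hy') (skew_comm hσ z' t)) (z + z') (t + t') := by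
  apply ext_of_coe
  rw [Subgroup.coe_mul, Units.val_mul, coe_nKlingen, coe_nKlingen, coe_nKlingen]
  ext i j
  fin_cases i <;> fin_cases j <;> simp [nKlingenM, Matrix.mul_apply, Fin.sum_univ_four] <;> ring

/-- `n_Q(0, 0, 0) = 1`. [cite: Xiong2013, §7 Lemma 7.1] -/
theorem nKlingen_zero (hσ : ∀ x, σ (σ x) = x) : nKlingen R σ hσ 0 skew_zero 0 0 = 1 := by
  apply ext_of_coe
  rw [coe_nKlingen]
  ext i j
  fin_cases i <;> fin_cases j <;> simp [nKlingenM]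

/-- **THE INVERSE IN `N_Q`**: `n_Q(y,z,t)⁻¹ = n_Q(−y + (z σ(t) − t σ(z)), −z, −t)`. [cite: Rogawski1990, §1.9] [cite: Xiong2013, §7 Lemma 7.1] -/
theorem nKlingen_inv (hσ : ∀ x, σ (σ x) = x) (y : R) (hy : σ y = -y) (z t : R) :
    (nKlingen R σ hσ y hy z t)⁻¹ = nKlingen R σ hσ (-y + (z * σ t - t * σ z)) (skew_add (skew_neg hy) (skew_comm hσ z t)) (-z) (-t) := by
  rw [inv_eq_iff_mul_eq_one, nKlingen_mul hσ, ← nKlingen_zero hσ]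
  congr 1
  · rw [map_neg]; ring
  · ring
  · ring

/-! ## §2 The subgroup `N_Q ≤ U(J₄)` and its coordinates -/

variable (R σ) in
/-- **the Heisenberg unipotent radical `N_Q = {n_Q(y, z, t) : σ y = −y} ≤ U(J₄)(R, σ)`** of the Klingen parabolic `Q = P_{α₂}` (a subgroup by the Heisenberg law
`nKlingen_mul` ∕ `nKlingen_inv`). [cite: MoeglinWaldspurger1995, I.2.1] [cite: Xiong2013, §7 Lemma 7.1] [cite: GanTakeda2011SiegelWeil, §7.2 p. 23] -/
def klingenUnip (hσ : ∀ x, σ (σ x) = x) : Subgroup (unitaryGroupOfForm σ ((StdForm.antidiagonal 4).over R)) where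
  carrier := {g | ∃ (y : R) (hy : σ y = -y) (z t : R), g = nKlingen R σ hσ y hy z t}
  one_mem' := ⟨0, skew_zero, 0, 0, (nKlingen_zero hσ).symm⟩
  mul_mem' := by
    rintro g g' ⟨y, hy, z, t, rfl⟩ ⟨y', hy', z', t', rfl⟩
    exact ⟨_, _, _, _, nKlingen_mul hσ y hy z t y' hy' z' t'⟩
  inv_mem' := by
    rintro g ⟨y, hy, z, t, rfl⟩
    exact ⟨_, _, _, _, nKlingen_inv hσ y hy z t⟩

/-- membership in `N_Q`. [cite: Xiong2013, §7 Lemma 7.1] -/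
theorem mem_klingenUnip_iff (hσ : ∀ x, σ (σ x) = x) (g : unitaryGroupOfForm σ ((StdForm.antidiagonal 4).over R)) :
    g ∈ klingenUnip R σ hσ ↔ ∃ (y : R) (hy : σ y = -y) (z t : R), g = nKlingen R σ hσ y hy z t :=
  Iff.rfl

/-- `n_Q(y,z,t) ∈ N_Q`. [cite: Xiong2013, §7 Lemma 7.1] -/
theorem nKlingen_mem_klingenUnip (hσ : ∀ x, σ (σ x) = x) (y : R) (hy : σ y = -y) (z t : R) :
    nKlingen R σ hσ y hy z t ∈ klingenUnip R σ hσ :=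
  ⟨y, hy, z, t, rfl⟩

/-- `u_{2e₁}(y) = n_Q(y, 0, 0)`. [cite: Xiong2013, §7 Lemma 7.1] -/
theorem uLongOne_eq_nKlingen (hσ : ∀ x, σ (σ x) = x) (y : R) (hy : σ y = -y) : uLongOne R σ y hy = nKlingen R σ hσ y hy 0 0 := by
  rw [nKlingen, uPlus_zero, uMinus_zero, mul_one, mul_one]

/-- `u_{e₁+e₂}(z) = n_Q(0, z, 0)`. [cite: Xiong2013, §7 Lemma 7.1] -/
theorem uPlus_eq_nKlingen (hσ : ∀ x, σ (σ x) = x) (z : R) : uPlus R σ hσ z = nKlingen R σ hσ 0 skew_zero z 0 := by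
  rw [nKlingen, uLongOne_zero, uMinus_zero, one_mul, mul_one]

/-- `u_{e₁−e₂}(t) = n_Q(0, 0, t)`. [cite: Xiong2013, §7 Lemma 7.1] -/
theorem uMinus_eq_nKlingen (hσ : ∀ x, σ (σ x) = x) (t : R) : uMinus R σ hσ t = nKlingen R σ hσ 0 skew_zero 0 t := by
  rw [nKlingen, uLongOne_zero, uPlus_zero, one_mul, one_mul]

/-- `u_{2e₁}(y) ∈ N_Q` (the centre). [cite: Rogawski1990, §1.9] -/
theorem uLongOne_mem_klingenUnip (hσ : ∀ x, σ (σ x) = x) (y : R) (hy : σ y = -y) : uLongOne R σ y hy ∈ klingenUnip R σ hσ :=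
  ⟨y, hy, 0, 0, uLongOne_eq_nKlingen hσ y hy⟩

/-- `u_{e₁+e₂}(z) ∈ N_Q`. [cite: Rogawski1990, §1.9] -/
theorem uPlus_mem_klingenUnip (hσ : ∀ x, σ (σ x) = x) (z : R) : uPlus R σ hσ z ∈ klingenUnip R σ hσ :=
  ⟨0, skew_zero, z, 0, uPlus_eq_nKlingen hσ z⟩

/-- `u_{e₁−e₂}(t) ∈ N_Q`. [cite: Rogawski1990, §1.9] -/
theorem uMinus_mem_klingenUnip (hσ : ∀ x, σ (σ x) = x) (t : R) : uMinus R σ hσ t ∈ klingenUnip R σ hσ :=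
  ⟨0, skew_zero, 0, t, uMinus_eq_nKlingen hσ t⟩

/-- **`N_Q ≤ P`** (the Siegel parabolic): the reason the identity cell of the Q-constant term of a Siegel Eisenstein series is `vol · f`.
[cite: Xiong2013, §4 Prop. 4.1] [cite: MoeglinWaldspurger1995, II.1.7] -/
theorem klingenUnip_le_siegelFour (hσ : ∀ x, σ (σ x) = x) : klingenUnip R σ hσ ≤ siegelFour R σ := by
  rintro g ⟨y, hy, z, t, rfl⟩
  exact (nKlingen_mem hσ y hy z t).1

/-- **`N_Q ≤ Q`**. [cite: MoeglinWaldspurger1995, I.2.1] -/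
theorem klingenUnip_le_klingen (hσ : ∀ x, σ (σ x) = x) : klingenUnip R σ hσ ≤ klingen R σ := by
  rintro g ⟨y, hy, z, t, rfl⟩
  exact (nKlingen_mem hσ y hy z t).2

/-- the coordinate `t` of `n_Q(y,z,t)` is the entry `(0,1)`. [cite: Xiong2013, §7 Lemma 7.1] -/
theorem nKlingen_entry_zero_one (hσ : ∀ x, σ (σ x) = x) (y : R) (hy : σ y = -y) (z t : R) :
    (((nKlingen R σ hσ y hy z t : unitaryGroupOfForm σ _) : GL (Fin 4) R) : Matrix (Fin 4) (Fin 4) R) 0 1 = t := by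
  rw [coe_nKlingen]; simp [nKlingenM]

/-- the coordinate `z` of `n_Q(y,z,t)` is the entry `(0,2)`. [cite: Xiong2013, §7 Lemma 7.1] -/
theorem nKlingen_entry_zero_two (hσ : ∀ x, σ (σ x) = x) (y : R) (hy : σ y = -y) (z t : R) :
    (((nKlingen R σ hσ y hy z t : unitaryGroupOfForm σ _) : GL (Fin 4) R) : Matrix (Fin 4) (Fin 4) R) 0 2 = z := by
  rw [coe_nKlingen]; simp [nKlingenM]

/-- the entry `(0,3)` of `n_Q(y,z,t)` is `y − z σ(t)` (so `y = g₀₃ + g₀₂ σ(g₀₁)`). [cite: Xiong2013, §7 Lemma 7.1] -/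
theorem nKlingen_entry_zero_three (hσ : ∀ x, σ (σ x) = x) (y : R) (hy : σ y = -y) (z t : R) :
    (((nKlingen R σ hσ y hy z t : unitaryGroupOfForm σ _) : GL (Fin 4) R) : Matrix (Fin 4) (Fin 4) R) 0 3 = y - z * σ t := by
  rw [coe_nKlingen]; simp [nKlingenM]

/-- **the coordinates are determined by the element**: `n_Q(y,z,t) = n_Q(y',z',t') → y = y' ∧ z = z' ∧ t = t'`. [cite: Xiong2013, §7 Lemma 7.1] -/
theorem nKlingen_injective (hσ : ∀ x, σ (σ x) = x) {y : R} {hy : σ y = -y} {z t : R} {y' : R} {hy' : σ y' = -y'} {z' t' : R}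
    (h : nKlingen R σ hσ y hy z t = nKlingen R σ hσ y' hy' z' t') : y = y' ∧ z = z' ∧ t = t' := by
  have ht : t = t' := by rw [← nKlingen_entry_zero_one hσ y hy z t, h, nKlingen_entry_zero_one]
  have hz : z = z' := by rw [← nKlingen_entry_zero_two hσ y hy z t, h, nKlingen_entry_zero_two]
  have h3 : y - z * σ t = y' - z' * σ t' := by rw [← nKlingen_entry_zero_three hσ y hy z t, h, nKlingen_entry_zero_three]
  refine ⟨?_, hz, ht⟩
  rw [hz, ht] at h3
  exact sub_left_injective h3

/-! ## §3 The cell-`ξ` stabiliser: `N_Q ∩ ξ⁻¹ P ξ = u_{e₁+e₂}` -/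

/-- matrix of `ξ n_Q(y,z,t) ξ⁻¹` (`ξ` permutes the basis `0 ↦ 2 ↦ 3 ↦ 1 ↦ 0`). [cite: Xiong2013, §7 Lemma 7.1] [cite: Casselman1980, §3] -/
theorem coe_weylXi_mul_nKlingen_mul_inv (hσ : ∀ x, σ (σ x) = x) (y : R) (hy : σ y = -y) (z t : R) :
    ((((weylXi R σ * nKlingen R σ hσ y hy z t * (weylXi R σ)⁻¹ : unitaryGroupOfForm σ _)) : GL (Fin 4) R) : Matrix (Fin 4) (Fin 4) R) =
      !![1, -σ z, 0, 0; 0, 1, 0, 0; t, y - z * σ t, 1, z; 0, -σ t, 0, 1] := by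
  rw [Subgroup.coe_mul, Units.val_mul, Subgroup.coe_mul, Units.val_mul, coe_weylXi, coe_nKlingen, coe_weylXi_inv]
  ext i j
  fin_cases i <;> fin_cases j <;> simp [weylXiM, nKlingenM, Matrix.mul_apply, Fin.sum_univ_four]

/-- **THE CELL-`ξ` STABILISER**: `ξ n_Q(y,z,t) ξ⁻¹ ∈ P ↔ y = 0 ∧ t = 0`, i.e. `N_Q ∩ ξ⁻¹Pξ = u_{e₁+e₂}(R)` — the roots `2e₁`, `e₁−e₂` are flipped by `ξ` (the
integration variables of `M(ξ,s)`), the root `e₁+e₂` is not. [cite: Xiong2013, §7 Lemma 7.1] [cite: GanTakeda2011SiegelWeil, §7.2 p. 23] [cite: Casselman1980, §3] -/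
theorem weylXi_conj_nKlingen_mem_siegelFour_iff (hσ : ∀ x, σ (σ x) = x) (y : R) (hy : σ y = -y) (z t : R) :
    weylXi R σ * nKlingen R σ hσ y hy z t * (weylXi R σ)⁻¹ ∈ siegelFour R σ ↔ y = 0 ∧ t = 0 := by
  rw [mem_siegelFour_iff, coe_weylXi_mul_nKlingen_mul_inv hσ]
  simp only [Matrix.of_apply, Matrix.cons_val', Matrix.cons_val_zero, Matrix.cons_val_one, Matrix.cons_val, Matrix.empty_val',
    Matrix.cons_val_fin_one]
  constructor
  · rintro ⟨ht, h3, -, -⟩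
    subst ht
    rw [map_zero, mul_zero, sub_zero] at h3
    exact ⟨h3, rfl⟩
  · rintro ⟨rfl, rfl⟩
    simp

/-- **the stabiliser in coordinates**: `n_Q(y,z,t) ∈ ξ⁻¹ P ξ ↔ n_Q(y,z,t) = u_{e₁+e₂}(z)`. [cite: Xiong2013, §7 Lemma 7.1] -/
theorem weylXi_conj_nKlingen_mem_siegelFour_iff_eq_uPlus (hσ : ∀ x, σ (σ x) = x) (y : R) (hy : σ y = -y) (z t : R) :
    weylXi R σ * nKlingen R σ hσ y hy z t * (weylXi R σ)⁻¹ ∈ siegelFour R σ ↔ nKlingen R σ hσ y hy z t = uPlus R σ hσ z := by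
  rw [weylXi_conj_nKlingen_mem_siegelFour_iff hσ, uPlus_eq_nKlingen hσ z]
  constructor
  · rintro ⟨rfl, rfl⟩; rfl
  · intro h
    obtain ⟨hy0, -, ht0⟩ := nKlingen_injective hσ h
    exact ⟨hy0, ht0⟩

/-- **`ξ u_{e₁+e₂}(z) ξ⁻¹ = u_{e₁−e₂}(−σ z) ∈ P`** (★ F1 `weylXi_mul_uPlus`): on the stabiliser the conjugate lands in the Siegel parabolic with trivial character data
(a Levi unipotent), so the compact quotient `u_{e₁+e₂}(L⁺)\u_{e₁+e₂}(𝔸)` integrates out of the cell-`ξ` term. [cite: GanTakeda2011SiegelWeil, §7.2 p. 23] -/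
theorem weylXi_mul_uPlus_mul_inv (hσ : ∀ x, σ (σ x) = x) (z : R) :
    weylXi R σ * uPlus R σ hσ z * (weylXi R σ)⁻¹ = uMinus R σ hσ (-σ z) := by
  rw [weylXi_mul_uPlus hσ, mul_inv_cancel_right]

end Summit.HodgeConjecture.HodgeConjecture.Cruxes.HLiu418.K2LiuKlingenUnipotentDefs

end
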